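import Literature.ModelTheory.Zilber.EACDensityTransport
import HarnessLib

/-!
# Multiplicatively dependent surfaces over a line: Mantova–Masser's typed density question holds

A pub-cell rung on the node `EACDensityQuestion` (Mantova–Masser, *Further remarks* §1 p. 5: are
the unprojected exponential points Zariski dense in a surface `S ⊆ ℂ² × (ℂˣ)²` of case
(dim-pi-S-1-free)? — "unclear, even for `n = 2`").  The answer to the question AS TYPED is NO in
general (`EACDensityOscillatory`: the resonant parabola `{x₁ = x₀²/(4πi), y₀ = 1}`, a
multiplicatively DEPENDENT surface); the repaired question adds "torus part multiplicatively free"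
and is OPEN.  This file decides the typed question completely on one structural class:

**Theorem** (`unprojectedDense_of_not_isMulFree_line`, `…_lineBase`).  Let `W` be in case
(dim-pi-S-1-free) with torus part `W ∩ G²` multiplicatively DEPENDENT (some non-trivial monomial
`y₀^{m₀} y₁^{m₁}` constant on it) and with base contained in a line `x₁ = a x₀ + b` (`a ∉ ℚ`; inside
the case every line base is of this form, vertical and horizontal lines having rational slope,
`isRationalSlopeLine_vertical`).  Then the exponential points of `W` are Zariski dense in `W`.

So among surfaces over a LINE the typed question and the repaired (free) question differ only by
positive instances; the counterexamples to the typed question necessarily have a non-linear base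
(as the resonant parabola does).

**Structure theorem behind it** (`exists_latticeClosure_eq_line_const`): such a `W` is a
`GL₂(ℤ)`-transform of a line-times-constant surface — there are an inverse pair `U, V ∈ GL₂(ℤ)`,
a line `x₁ = a' x₀ + b'` and `ρ ≠ 0` with `W^U = {x₁ = a' x₀ + b', y₀ = ρ}`.  Proof: write the
relation as `(y^{m'})^g = c` with `m' = (p, q)` primitive, complete `m'` to `U = (p q; -v u)`
(Bezout), so that `Φ_U` makes `y^{m'}` the first multiplicative coordinate: `Φ_U(W ∩ G²)` lies in
the finite union of the sheets `{x₁ = a' x₀ + b', y₀ = ρ}`, `ρ^g = c`; an irreducible closed set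
with a dense subset inside a finite union of closed sets lies in one of them
(`exists_subset_of_dense_subset_biUnion`, prime avoidance); and a closed subset of an irreducible
surface of the same dimension is all of it (`eq_of_subset_of_zariskiDim_eq`, the dimension drop
`dim A/J + 1 ≤ dim A` of `Literature.RingTheory.KrullDimension`).  Density then follows from the
`GL₂(ℤ)`-invariance of the case and of density (`EACDensityTransport`, Part 1) and the decided
line-times-constant family (`mmCase_iff_unprojectedDense_line_const`, via `EACDensityPhases`).

HONEST FRAMING.  Elementary structure theory plus the invariance file; the decided class is the
"cheap" half of the line node (dependent torus part).  The free question — in particular lines of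
REAL irrational slope with a non-monomial fibre — stays OPEN, as do `ECCell 3 2` and everything
about Schanuel's conjecture (EAC ⇏ SC).  No new analysis.
-/

noncomputable section

open MvPolynomial Matrix Complex

namespace Literature.ModelTheory.Zilber

open Literature.NumberTheory.Transcendental
open Literature.ModelTheory.ExponentialFields

/-! ## Part 1 — two facts of elementary structure theory -/

section Structure

variable {K : Type*} [Field K] {ι : Type*}

/-- **Prime avoidance for closed sheets.** If `I(W)` is prime and a subset `A` with `I(A) = I(W)`
(e.g. a Zariski dense subset of `W`) lies in a finite union of Zariski closed sets `Z i`, then `W`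
lies in one of them: otherwise pick `fᵢ` vanishing on `Z i` but not on `W`; `∏ fᵢ` vanishes on `A`,
so lies in the prime `I(W)`, so some `fᵢ ∈ I(W)` — contradiction. [folklore] -/
theorem exists_subset_of_dense_subset_biUnion {α : Type*} {W A : Set (ι → K)}
    (hW : (vanishingIdeal K W).IsPrime) (hA : vanishingIdeal K A = vanishingIdeal K W)
    (s : Finset α) (Z : α → Set (ι → K)) (hZ : ∀ i ∈ s, IsZariskiClosed K (Z i))
    (hAZ : A ⊆ ⋃ i ∈ s, Z i) : ∃ i ∈ s, W ⊆ Z i := by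
  classical
  by_contra hcon
  push Not at hcon
  have h' : ∀ i ∈ s, ∃ f : MvPolynomial ι K,
      (∀ z ∈ Z i, aeval z f = 0) ∧ ∃ w ∈ W, aeval w f ≠ 0 := by
    intro i hi
    obtain ⟨w, hwW, hwZ⟩ := Set.not_subset.1 (hcon i hi)
    obtain ⟨J, hJ⟩ := hZ i hi
    rw [hJ, mem_zeroLocus_iff] at hwZ
    push Not at hwZ
    obtain ⟨f, hfJ, hfw⟩ := hwZ
    refine ⟨f, fun z hz => ?_, w, hwW, hfw⟩
    rw [hJ, mem_zeroLocus_iff] at hz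
    exact hz f hfJ
  choose! f hf using h'
  have hprod : ∏ i ∈ s, f i ∈ vanishingIdeal K W := by
    rw [← hA, mem_vanishingIdeal_iff]
    intro z hz
    obtain ⟨i, hi, hzi⟩ := Set.mem_iUnion₂.1 (hAZ hz)
    rw [map_prod]
    exact Finset.prod_eq_zero hi ((hf i hi).1 z hzi)
  obtain ⟨i, hi, hfi⟩ := (Ideal.IsPrime.prod_mem_iff (hp := hW)).1 hprod
  obtain ⟨w, hwW, hfw⟩ := (hf i hi).2
  exact hfw ((mem_vanishingIdeal_iff.1 hfi) w hwW)

/-- **Dimension rigidity.** A Zariski closed subset `S` of an irreducible closed `T` with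
`dim S = dim T` (finite) is all of `T`: otherwise `I(T) < I(S)` and
`dim K[X]/I(S) + 1 ≤ dim K[X]/I(T)` (`ringKrullDim_quotient_add_one_le` in the domain
`K[X]/I(T)`). [folklore] -/
theorem eq_of_subset_of_zariskiDim_eq {S T : Set (ι → K)} (hS : IsZariskiClosed K S)
    (hT : IsIrreducibleClosed K T) (hST : S ⊆ T) {d : ℕ} (hdS : zariskiDim K S = d)
    (hdT : zariskiDim K T = d) : S = T := by
  by_contra hne
  have hle : vanishingIdeal K T ≤ vanishingIdeal K S := vanishingIdeal_anti_mono hST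
  have hneI : vanishingIdeal K T ≠ vanishingIdeal K S := by
    intro h
    apply hne
    rw [eq_zeroLocus_vanishingIdeal_of_isZariskiClosed hS,
      eq_zeroLocus_vanishingIdeal_of_isZariskiClosed hT.1, h]
  haveI := hT.2
  haveI : IsDomain (MvPolynomial ι K ⧸ vanishingIdeal K T) :=
    Ideal.Quotient.isDomain (vanishingIdeal K T)
  have hmap : (vanishingIdeal K S).map (Ideal.Quotient.mk (vanishingIdeal K T)) ≠ ⊥ := by
    intro h
    apply hneI
    refine le_antisymm hle fun f hf => ?_
    have : Ideal.Quotient.mk (vanishingIdeal K T) f ∈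
        (vanishingIdeal K S).map (Ideal.Quotient.mk (vanishingIdeal K T)) :=
      Ideal.mem_map_of_mem _ hf
    rw [h, Ideal.mem_bot, Ideal.Quotient.eq_zero_iff_mem] at this
    exact this
  have h := Literature.RingTheory.KrullDimension.ringKrullDim_quotient_add_one_le hmap
  rw [ringKrullDim_eq_of_ringEquiv (DoubleQuot.quotQuotEquivQuotOfLE hle)] at h
  change zariskiDim K S + 1 ≤ zariskiDim K T at h
  rw [hdS, hdT] at h
  have h' : ((d + 1 : ℕ) : WithBot ℕ∞) ≤ (d : WithBot ℕ∞) := by push_cast; exact h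
  have h'' : d + 1 ≤ d := by exact_mod_cast h'
  omega

end Structure

/-! ## Part 2 — lines: vertical lines have rational slope; lines under `x ↦ U x` -/

section Lines

variable {K : Type*} [Field K]

/-- A vertical line `x₀ = c` is a line of rational slope (`m = (1, 0)`); so inside case
(dim-pi-S-1-free) a line base is never vertical and can be written `x₁ = a x₀ + b`. [folklore] -/
theorem isRationalSlopeLine_vertical (c : K) : IsRationalSlopeLine {x : Fin 2 → K | x 0 = c} := by
  refine ⟨![1, 0], ?_, c, ?_⟩
  · intro h
    have h0 := congr_fun h 0
    simp at h0
  · ext x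
    simp

/-- A horizontal line `x₁ = b` is a line of rational slope (`m = (0, 1)`). [folklore] -/
theorem isRationalSlopeLine_horizontal (b : K) :
    IsRationalSlopeLine {x : Fin 2 → K | x 1 = b} := by
  refine ⟨![0, 1], ?_, b, ?_⟩
  · intro h
    have h1 := congr_fun h 1
    simp at h1
  · ext x
    simp

/-- A line `x₁ = r x₀ + b` of rational slope `r ∈ ℚ` is a line of rational slope in
Mantova–Masser's sense (`den(r) x₁ - num(r) x₀ = den(r) b`). [folklore] -/
theorem isRationalSlopeLine_line_rat (r : ℚ) (b : ℂ) :
    IsRationalSlopeLine {x : Fin 2 → ℂ | x 1 = (r : ℂ) * x 0 + b} := by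
  have hden : (r.den : ℂ) ≠ 0 := Nat.cast_ne_zero.2 r.den_nz
  refine ⟨![-r.num, (r.den : ℤ)], ?_, (r.den : ℂ) * b, ?_⟩
  · intro h
    have h1 := congr_fun h 1
    simp only [Matrix.cons_val_one, Matrix.cons_val_fin_one, Pi.zero_apply, Nat.cast_eq_zero] at h1
    exact r.den_nz h1
  · ext x
    simp only [Set.mem_setOf_eq, Matrix.cons_val_zero, Matrix.cons_val_one, Matrix.cons_val_fin_one,
      Int.cast_neg, Int.cast_natCast]
    rw [Rat.cast_def]
    constructor
    · intro h
      rw [h]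
      field_simp
      ring
    · intro h
      field_simp
      linear_combination h

/-- `(U x)_i = U_{i0} x₀ + U_{i1} x₁` on `K²`. [folklore] -/
theorem intLinMap_apply_two (U : Matrix (Fin 2) (Fin 2) ℤ) (x : Fin 2 → K) (i : Fin 2) :
    intLinMap U x i = (U i 0 : K) * x 0 + (U i 1 : K) * x 1 := by
  simp [intLinMap, Fin.sum_univ_two]

/-- `(y^U)_i = y₀ ^ U_{i0} * y₁ ^ U_{i1}` on `K²`. [folklore] -/
theorem monomialMap_apply_two (U : Matrix (Fin 2) (Fin 2) ℤ) (y : Fin 2 → K) (i : Fin 2) :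
    monomialMap U y i = y 0 ^ U i 0 * y 1 ^ U i 1 := by
  simp [monomialMap, Fin.prod_univ_two]

/-- The slope of the image of the line `x₁ = a x₀ + b` under `x ↦ U x` (when the image is not
vertical, i.e. `U₀₀ + U₀₁ a ≠ 0`): `(U₁₀ + U₁₁ a)/(U₀₀ + U₀₁ a)`. [folklore] -/
def slopeTransf (U : Matrix (Fin 2) (Fin 2) ℤ) (a : K) : K :=
  ((U 1 0 : K) + (U 1 1 : K) * a) / ((U 0 0 : K) + (U 0 1 : K) * a)

/-- The intercept of the image line: `U₁₁ b - a' U₀₁ b`. [folklore] -/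
def interceptTransf (U : Matrix (Fin 2) (Fin 2) ℤ) (a b : K) : K :=
  (U 1 1 : K) * b - slopeTransf U a * ((U 0 1 : K) * b)

/-- **Lines go to lines**: if `x₁ = a x₀ + b` and `U₀₀ + U₀₁ a ≠ 0` then
`(U x)₁ = a' (U x)₀ + b'` with `a' = slopeTransf U a`, `b' = interceptTransf U a b`. [folklore] -/
theorem intLinMap_line (U : Matrix (Fin 2) (Fin 2) ℤ) {a b : K} {x : Fin 2 → K}
    (hx : x 1 = a * x 0 + b) (hδ : (U 0 0 : K) + (U 0 1 : K) * a ≠ 0) :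
    intLinMap U x 1 = slopeTransf U a * intLinMap U x 0 + interceptTransf U a b := by
  rw [intLinMap_apply_two, intLinMap_apply_two, hx]
  set δ : K := (U 0 0 : K) + (U 0 1 : K) * a with hδdef
  set N : K := (U 1 0 : K) + (U 1 1 : K) * a with hN
  have key : (U 0 0 : K) * x 0 + (U 0 1 : K) * (a * x 0 + b) = δ * x 0 + (U 0 1 : K) * b := by
    rw [hδdef]; ring
  rw [key, interceptTransf, slopeTransf, ← hδdef, ← hN]
  have h1 : N / δ * (δ * x 0 + (U 0 1 : K) * b) = N * x 0 + N / δ * ((U 0 1 : K) * b) := by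
    rw [mul_add, ← mul_assoc, div_mul_cancel₀ N hδ]
  rw [h1, hN]
  ring

end Lines

/-! ## Part 3 — completing a primitive vector to `GL₂(ℤ)` (Bezout) -/

section Bezout

/-- The matrix `(p q; -v u)`; for `p u + q v = 1` it lies in `SL₂(ℤ)` and its first row is
`(p, q)`. [folklore] -/
def bezoutMat (p q u v : ℤ) : Matrix (Fin 2) (Fin 2) ℤ := !![p, q; -v, u]

/-- Its inverse `(u -q; v p)`. [folklore] -/
def bezoutInv (p q u v : ℤ) : Matrix (Fin 2) (Fin 2) ℤ := !![u, -q; v, p]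

/-- `(p q; -v u)(u -q; v p) = 1` when `p u + q v = 1`. [folklore] -/
theorem bezoutMat_mul_bezoutInv {p q u v : ℤ} (h : p * u + q * v = 1) :
    bezoutMat p q u v * bezoutInv p q u v = 1 := by
  ext i j
  fin_cases i <;> fin_cases j <;>
    simp [bezoutMat, bezoutInv, Matrix.mul_apply, Fin.sum_univ_two] <;>
    first | linear_combination h | ring1

/-- `(u -q; v p)(p q; -v u) = 1` when `p u + q v = 1`. [folklore] -/
theorem bezoutInv_mul_bezoutMat {p q u v : ℤ} (h : p * u + q * v = 1) :
    bezoutInv p q u v * bezoutMat p q u v = 1 := by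
  ext i j
  fin_cases i <;> fin_cases j <;>
    simp [bezoutMat, bezoutInv, Matrix.mul_apply, Fin.sum_univ_two] <;>
    first | linear_combination h | ring1

/-- The first multiplicative coordinate after `Φ_U`, `U = (p q; -v u)`, is the monomial
`y₀^p y₁^q`. [folklore] -/
theorem latticeChange_bezoutMat_inr_zero {K : Type*} [Field K] (p q u v : ℤ)
    (z : Fin 2 ⊕ Fin 2 → K) :
    latticeChange (bezoutMat p q u v) z (Sum.inr 0) = z (Sum.inr 0) ^ p * z (Sum.inr 1) ^ q := by
  rw [latticeChange_inr, monomialMap_apply_two]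
  simp [bezoutMat]

end Bezout

/-! ## Part 4 — the structure theorem and the density theorem -/

section Main

/-- Inside case (dim-pi-S-1-free) the closure of the base is never a vertical line (vertical lines
have rational slope); so "the base is a line" may always be written `x₁ = a x₀ + b`. [folklore] -/
theorem not_mmCase_of_base_vertical {W : Set (Fin 2 ⊕ Fin 2 → ℂ)} {c : ℂ}
    (hB : zeroLocus ℂ (vanishingIdeal ℂ (projAdd '' (W ∩ torusLocus ℂ 2))) =
      {x : Fin 2 → ℂ | x 0 = c}) : ¬ MMCaseDimPiOneFree W := by
  intro hW
  apply hW.2.2.2.2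
  rw [hB]
  exact isRationalSlopeLine_vertical c

/-- A multiplicative relation `∏ yᵢ^{mᵢ} = c` on a set meeting the torus has `c ≠ 0`.
[folklore] -/
theorem ne_zero_of_mul_relation {W : Set (Fin 2 ⊕ Fin 2 → ℂ)} (hne : (W ∩ torusLocus ℂ 2).Nonempty)
    {m : Fin 2 → ℤ} {c : ℂ} (hc : ∀ z ∈ W ∩ torusLocus ℂ 2, ∏ i, z (Sum.inr i) ^ m i = c) :
    c ≠ 0 := by
  obtain ⟨z, hz⟩ := hne
  rw [← hc z hz]
  exact Finset.prod_ne_zero_iff.2 fun i _ => zpow_ne_zero _ ((mem_torusLocus_iff.1 hz.2) i)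

/-- **Structure theorem.** A surface `W` of case (dim-pi-S-1-free) whose torus part is
multiplicatively dependent and whose base lies in the line `x₁ = a x₀ + b` (`a ∉ ℚ`) is a
`GL₂(ℤ)`-transform of a line-times-constant surface: `W^U = {x₁ = a' x₀ + b', y₀ = ρ}` for an
inverse pair `U, V` and some `a', b'`, `ρ ≠ 0`. [folklore] -/
theorem exists_latticeClosure_eq_line_const {W : Set (Fin 2 ⊕ Fin 2 → ℂ)}
    (hW : MMCaseDimPiOneFree W) {a b : ℂ} (ha : ∀ r : ℚ, a ≠ (r : ℂ))
    (hL : ∀ z ∈ W ∩ torusLocus ℂ 2, z (Sum.inl 1) = a * z (Sum.inl 0) + b)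
    (hdep : ¬ IsMulFree ℂ 2 (W ∩ torusLocus ℂ 2)) :
    ∃ U V : Matrix (Fin 2) (Fin 2) ℤ, U * V = 1 ∧ V * U = 1 ∧ ∃ a' b' ρ : ℂ, ρ ≠ 0 ∧
      latticeClosure U W = graphPolySurface (linePoly a' b') (Polynomial.C ρ) := by
  classical
  have hWirr := hW.1
  have hne := hW.2.1
  -- the relation `y^m = c`, `m ≠ 0`
  unfold IsMulFree at hdep
  push Not at hdep
  obtain ⟨m, hm0, c, hc⟩ := hdep
  have hc0 : c ≠ 0 := ne_zero_of_mul_relation hne hc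
  -- its primitive part `m = g • (p, q)`, Bezout `p u + q v = 1`
  have hgpos : 0 < Int.gcd (m 0) (m 1) := by
    refine Int.gcd_pos_iff.2 ?_
    by_contra h
    push Not at h
    apply hm0
    funext i
    fin_cases i
    · exact h.1
    · exact h.2
  obtain ⟨g, p, q, hg, hpq, hp, hq⟩ := Int.exists_gcd_one' hgpos
  set u := Int.gcdA p q with hu
  set v := Int.gcdB p q with hv
  have huv : p * u + q * v = 1 := by
    have h := Int.gcd_eq_gcd_ab p q
    rw [hpq, Nat.cast_one] at h
    rw [hu, hv]
    exact h.symm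
  set U := bezoutMat p q u v with hUdef
  set V := bezoutInv p q u v with hVdef
  have hUV : U * V = 1 := bezoutMat_mul_bezoutInv huv
  have hVU : V * U = 1 := bezoutInv_mul_bezoutMat huv
  -- the image line is not vertical: `p + q a ≠ 0`
  have hδ : (U 0 0 : ℂ) + (U 0 1 : ℂ) * a ≠ 0 := by
    have h00 : U 0 0 = p := by simp [hUdef, bezoutMat]
    have h01 : U 0 1 = q := by simp [hUdef, bezoutMat]
    rw [h00, h01]
    intro h
    by_cases hq0 : q = 0
    · rw [hq0, Int.cast_zero, zero_mul, add_zero, Int.cast_eq_zero] at h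
      rw [h, hq0, Int.gcd_zero_right, Int.natAbs_zero] at hpq
      exact zero_ne_one hpq
    · apply ha (-(p : ℚ) / q)
      have hqC : (q : ℂ) ≠ 0 := Int.cast_ne_zero.2 hq0
      push_cast
      rw [eq_div_iff hqC]
      linear_combination h
  set a' : ℂ := slopeTransf U a with ha'
  set b' : ℂ := interceptTransf U a b with hb'
  -- `Φ_U(W ∩ G²)` lies in the union of the sheets `{x₁ = a' x₀ + b', y₀ = ρ}`, `ρ^g = c`
  have himg : latticeImage U W ⊆ ⋃ ρ ∈ Polynomial.nthRootsFinset g c,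
      graphPolySurface (linePoly a' b') (Polynomial.C ρ) := by
    rintro _ ⟨z, hz, rfl⟩
    have hη : (z (Sum.inr 0) ^ p * z (Sum.inr 1) ^ q) ^ g = c := by
      rw [← hc z hz, Fin.prod_univ_two, hp, hq, mul_pow, ← zpow_natCast, ← zpow_natCast,
        ← _root_.zpow_mul, ← _root_.zpow_mul]
    refine Set.mem_biUnion ((Polynomial.mem_nthRootsFinset hg c).2 hη) ?_
    rw [mem_graphPolySurface_iff, eval_linePoly, Polynomial.eval_C, latticeChange_inl,
      latticeChange_inl, hUdef, latticeChange_bezoutMat_inr_zero, ← hUdef]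
    exact ⟨intLinMap_line U (by simpa [projAdd_apply] using hL z hz) hδ, rfl⟩
  -- `W^U` is irreducible closed with dense subset `Φ_U(W ∩ G²)`: it lies in ONE sheet
  obtain ⟨ρ, hρ, hsub⟩ := exists_subset_of_dense_subset_biUnion
    (isIrreducibleClosed_latticeClosure U hWirr hne).2 (vanishingIdeal_latticeClosure U W).symm
    (Polynomial.nthRootsFinset g c) (fun ρ => graphPolySurface (linePoly a' b') (Polynomial.C ρ))
    (fun ρ _ => (isIrreducibleClosed_graphPolySurface _ _).1) himg
  have hρg : ρ ^ g = c := (Polynomial.mem_nthRootsFinset hg c).1 hρ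
  have hρ0 : ρ ≠ 0 := by
    rintro rfl
    rw [zero_pow hg.ne'] at hρg
    exact hc0 hρg.symm
  -- same dimension: `W^U` IS the sheet
  have hcaseU : MMCaseDimPiOneFree (latticeClosure U W) :=
    mmCaseDimPiOneFree_latticeClosure hUV hVU hW
  refine ⟨U, V, hUV, hVU, a', b', ρ, hρ0, ?_⟩
  exact eq_of_subset_of_zariskiDim_eq hcaseU.1.1 (isIrreducibleClosed_graphPolySurface _ _) hsub
    hcaseU.2.2.1 (zariskiDim_graphPolySurface _ _)

/-- **Density theorem (typed question, dependent torus part, line base).** If `W` is in case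
(dim-pi-S-1-free), its torus part is multiplicatively dependent, and its base lies in a line
`x₁ = a x₀ + b` with `a ∉ ℚ`, then the exponential points of `W` are Zariski dense in `W`.
(The structure theorem puts `W^U = {line} × {y₀ = ρ}`; the case transports to `W^U`, where it
reads "slope `∉ ℚ`" and is equivalent to density (`mmCase_iff_unprojectedDense_line_const`); density
transports back.) [folklore] -/
theorem unprojectedDense_of_not_isMulFree_line {W : Set (Fin 2 ⊕ Fin 2 → ℂ)}
    (hW : MMCaseDimPiOneFree W) {a b : ℂ} (ha : ∀ r : ℚ, a ≠ (r : ℂ))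
    (hL : ∀ z ∈ W ∩ torusLocus ℂ 2, z (Sum.inl 1) = a * z (Sum.inl 0) + b)
    (hdep : ¬ IsMulFree ℂ 2 (W ∩ torusLocus ℂ 2)) : UnprojectedDense W := by
  obtain ⟨U, V, hUV, hVU, a', b', ρ, hρ0, heq⟩ := exists_latticeClosure_eq_line_const hW ha hL hdep
  have hcaseU : MMCaseDimPiOneFree (latticeClosure U W) :=
    mmCaseDimPiOneFree_latticeClosure hUV hVU hW
  rw [heq] at hcaseU
  have hdense : UnprojectedDense (graphPolySurface (linePoly a' b') (Polynomial.C ρ)) :=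
    (mmCase_iff_unprojectedDense_line_const (Complex.exp_log hρ0)).1 hcaseU
  rw [← heq] at hdense
  exact (unprojectedDense_latticeClosure_iff hUV hVU hW.1 hW.2.1).1 hdense

/-- **… and `W` itself is the inverse transform**: `W = ({x₁ = a' x₀ + b', y₀ = ρ})^V`.  So the
surfaces of the case with dependent torus part over a line are exactly the `GL₂(ℤ)`-transforms of
line-times-constant surfaces (converse: `dependent_line_instance_latticeClosure`). [folklore] -/
theorem exists_eq_latticeClosure_line_const {W : Set (Fin 2 ⊕ Fin 2 → ℂ)}
    (hW : MMCaseDimPiOneFree W) {a b : ℂ} (ha : ∀ r : ℚ, a ≠ (r : ℂ))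
    (hL : ∀ z ∈ W ∩ torusLocus ℂ 2, z (Sum.inl 1) = a * z (Sum.inl 0) + b)
    (hdep : ¬ IsMulFree ℂ 2 (W ∩ torusLocus ℂ 2)) :
    ∃ U V : Matrix (Fin 2) (Fin 2) ℤ, U * V = 1 ∧ V * U = 1 ∧ ∃ a' b' ρ : ℂ, ρ ≠ 0 ∧
      W = latticeClosure V (graphPolySurface (linePoly a' b') (Polynomial.C ρ)) := by
  obtain ⟨U, V, hUV, hVU, a', b', ρ, hρ0, heq⟩ := exists_latticeClosure_eq_line_const hW ha hL hdep
  refine ⟨U, V, hUV, hVU, a', b', ρ, hρ0, ?_⟩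
  have hVimg : latticeImage V (latticeClosure U W) = W ∩ torusLocus ℂ 2 := by
    rw [latticeImage_congr_inter V ((latticeClosure_inter_torusLocus hUV hVU hW.1.1).trans
      (latticeImage_inter_torusLocus U W).symm), latticeImage_latticeImage_of_mul_eq_one hVU]
  rw [← heq, latticeClosure, hVimg, vanishingIdeal_inter_torusLocus_of_irred hW.1 hW.2.1]
  exact eq_zeroLocus_vanishingIdeal_of_isZariskiClosed hW.1.1

/-- **Converse**: every `GL₂(ℤ)`-transform of a line-times-constant surface
`{x₁ = a' x₀ + b', y₀ = ρ}` (`a' ∉ ℚ`, `ρ ≠ 0`) is in the case, has multiplicatively dependent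
torus part, and has Zariski dense exponential points. [folklore] -/
theorem dependent_line_instance_latticeClosure {U V : Matrix (Fin 2) (Fin 2) ℤ} (hUV : U * V = 1)
    (hVU : V * U = 1) {a' : ℂ} (b' : ℂ) (ha' : ∀ r : ℚ, a' ≠ (r : ℂ)) {ρ : ℂ} (hρ : ρ ≠ 0) :
    MMCaseDimPiOneFree (latticeClosure V (graphPolySurface (linePoly a' b') (Polynomial.C ρ))) ∧
      ¬ IsMulFree ℂ 2 (latticeClosure V (graphPolySurface (linePoly a' b') (Polynomial.C ρ)) ∩
          torusLocus ℂ 2) ∧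
      UnprojectedDense (latticeClosure V (graphPolySurface (linePoly a' b') (Polynomial.C ρ))) := by
  have hq : (Polynomial.C ρ) ≠ 0 := Polynomial.C_ne_zero.2 hρ
  have hcase : MMCaseDimPiOneFree (graphPolySurface (linePoly a' b') (Polynomial.C ρ)) :=
    mmCase_graphPolySurface_line ha' hq
  refine ⟨mmCaseDimPiOneFree_latticeClosure hVU hUV hcase, fun hfree => ?_,
    unprojectedDense_latticeClosure hVU hUV hcase.1.1
      ((mmCase_iff_unprojectedDense_line_const (Complex.exp_log hρ)).1 hcase)⟩
  have h := isMulFree_latticeClosure_inter hUV hVU (isZariskiClosed_latticeClosure V _) hfree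
  rw [latticeClosure_latticeClosure_inter_torusLocus hVU hUV
    (isIrreducibleClosed_graphPolySurface _ _).1] at h
  exact not_isMulFree_graphPolySurface_C _ _ h

/-- **The same with the base given as a closure**: if `cl π(W ∩ G²)` is the line `x₁ = a x₀ + b`
then automatically `a ∉ ℚ` (the case excludes lines of rational slope) and the base condition
holds pointwise. [folklore] -/
theorem unprojectedDense_of_not_isMulFree_lineBase {W : Set (Fin 2 ⊕ Fin 2 → ℂ)}
    (hW : MMCaseDimPiOneFree W) {a b : ℂ}
    (hB : zeroLocus ℂ (vanishingIdeal ℂ (projAdd '' (W ∩ torusLocus ℂ 2))) =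
      {x : Fin 2 → ℂ | x 1 = a * x 0 + b})
    (hdep : ¬ IsMulFree ℂ 2 (W ∩ torusLocus ℂ 2)) : UnprojectedDense W := by
  have hL : ∀ z ∈ W ∩ torusLocus ℂ 2, z (Sum.inl 1) = a * z (Sum.inl 0) + b := by
    intro z hz
    have h : projAdd z ∈ zeroLocus ℂ (vanishingIdeal ℂ (projAdd '' (W ∩ torusLocus ℂ 2))) :=
      zeroLocus_vanishingIdeal_le _ (Set.mem_image_of_mem _ hz)
    rw [hB] at h
    simpa [projAdd_apply] using h
  have ha : ∀ r : ℚ, a ≠ (r : ℂ) := by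
    intro r har
    apply hW.2.2.2.2
    rw [hB, har]
    exact isRationalSlopeLine_line_rat r b
  exact unprojectedDense_of_not_isMulFree_line hW ha hL hdep

/-- **Positive instances of Mantova–Masser's question as typed**: every surface of the case with
dependent torus part over a line base is one (case ∧ dense).  Contrast `EACDensityOscillatory`:
over the parabola `x₁ = x₀²/(4πi)` a dependent surface of the case is NOT dense — the
counterexamples to the typed question have non-linear bases. [folklore] -/
theorem unprojectedDensityQuestion_instance_dependent_line {W : Set (Fin 2 ⊕ Fin 2 → ℂ)}
    (hW : MMCaseDimPiOneFree W) {a b : ℂ}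
    (hB : zeroLocus ℂ (vanishingIdeal ℂ (projAdd '' (W ∩ torusLocus ℂ 2))) =
      {x : Fin 2 → ℂ | x 1 = a * x 0 + b})
    (hdep : ¬ IsMulFree ℂ 2 (W ∩ torusLocus ℂ 2)) : MMCaseDimPiOneFree W ∧ UnprojectedDense W :=
  ⟨hW, unprojectedDense_of_not_isMulFree_lineBase hW hB hdep⟩

end Main

end Literature.ModelTheory.Zilber

end
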